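import Summits.KontsevichZagierPeriods.KontsevichZagierPeriods.Theses.SymplecticScissors
import Literature.NumberTheory.Transcendental.AyoubPeriodSeries
import Literature.NumberTheory.Transcendental.AyoubPeriodSeriesKernel
import Literature.NumberTheory.Transcendental.AyoubPeriodSeriesPiAlgebraic
import Literature.NumberTheory.Transcendental.AyoubPeriodSeriesLocalizing
import Literature.NumberTheory.Transcendental.AyoubPeriodSeriesDescent
import Mathlib.RingTheory.MvPowerSeries.Substitution
import Mathlib.RingTheory.AlgebraicIndependent.Transcendental
import Mathlib.FieldTheory.AlgebraicClosure
import Summits.KontsevichZagierPeriods.KontsevichZagierPeriods.Theorems.SymplecticScissorsTypeAGenerationStubSubstRoomAux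
import Summits.KontsevichZagierPeriods.KontsevichZagierPeriods.Theorems.SymplecticScissorsTypeAGenerationStubRestrCOneAux
import Summits.KontsevichZagierPeriods.KontsevichZagierPeriods.Theorems.SymplecticScissorsTypeAGenerationStubRestrCZero
import Summits.KontsevichZagierPeriods.KontsevichZagierPeriods.Theorems.SymplecticScissorsTypeAGenerationStubRoomLemmaIter
import Summits.KontsevichZagierPeriods.KontsevichZagierPeriods.Theorems.SymplecticScissorsTypeAGenerationStubPartialFractions

/-!
# `TypeAGeneration` (stmt-KontsevichZagierPeriods-18392), line `Sketch`: stub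
`stub_covSubstMemOan_of` (V1) — membership of the substituted series `f(H)`, `f(u(zᵢ))`

Crux `Summit.KontsevichZagierPeriods.KontsevichZagierPeriods.Theses.SymplecticScissors.TypeAGeneration`
(Ayoub 2015 Conj. 1.1 = Fresán 2024 Conj. 3.5), line `Sketch`, engine (C3, `n = 1`): change of
variables in dimension one inside type (a) (Ayoub 2015 Rem. 1.5), along the straight-line homotopy
`H = zᵢ(1 − z_j) + u(zᵢ) z_j` between `zᵢ` and `u(zᵢ)` for a polynomial `u` with ALGEBRAIC
coefficients and `u(0) = 0`.

Registered stub V1, an implication out of the analytic package V0 (`stub_covSubstAnalytic`: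
admissibility of the substitutions `zᵢ ↦ H` and `zᵢ ↦ u(zᵢ)`, variables, coefficient formulas, a
weight `ρ > 1` with finite weighted norms): for a one-variable `f ∈ 𝒪_{ℚ-alg}(𝔻̄^∞)` (variable
`zᵢ`) with room, `f(H) = MvPowerSeries.subst covFam f` and `f(u(zᵢ)) = MvPowerSeries.subst uFam f`
lie in `𝒪_{ℚ-alg}(𝔻̄^∞) = AyoubRel.Oan (algebraMap ℚ ℂ)`.

* finitely many variables and polyradius `> 1`: read off V0 (`s6_dependsOnlyOnLT_of_usesVar`,
  `s4_prod_const_pow`);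
* **algebraicity** (the content): over `ℚ̄ = algebraicClosure ℚ ℂ` (where `u` lifts to `u₀ ∈ ℚ̄[t]`,
  `pb_lift`; `𝒪_{ℚ-alg} = 𝒪_{ℚ̄-alg}`, `Oan_algebraicClosure_eq_Oan_rat`), an algebraic relation
  `P(f) = 0` over `ℚ̄[z]` is transported along the substitution (`v1_isAlgebraic_subst`, the square
  `subst a ∘ polyToCSeries = polyToCSeries ∘ bind₁ g`), provided the polynomial substitution
  `bind₁ g` of `ℚ̄[z]` is injective: for `zᵢ ↦ H₀ = zᵢ(1 − z_j) + u₀(zᵢ) z_j` because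
  `H₀ ≡ zᵢ (mod z_j)` (`v1_polyMap_injective`: a kernel element is divisible by every power of `z_j`,
  descent on the total degree), for `zᵢ ↦ u₀(zᵢ)` with `u₀` non-constant by Mathlib's
  `MvPolynomial.algebraicIndependent_polynomial_aeval_X`; for `u = 0`, `f(u(zᵢ)) = f|_{zᵢ=0}`
  (`stub_restrCZeroMemOan`).

Elementary (folklore); no definition is introduced.
-/

noncomputable section

-- `Summit.KontsevichZagierPeriods.KontsevichZagierPeriods.…` is the tree's mandated layout (single-conjunct summit).
set_option linter.dupNamespace false

namespace Summit.KontsevichZagierPeriods.KontsevichZagierPeriods.TypeAGenerationLine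

open Finsupp MvPowerSeries
open Literature.NumberTheory.Transcendental
open Literature.NumberTheory.Transcendental.AyoubRel

/-- The straight-line homotopy `H = zᵢ(1 − z_j) + u(zᵢ) z_j`. -/
local notation3 "covH[" i ", " j ", " u "]" =>
  ((X i : CSeries) * (1 - X j) + Polynomial.aeval (X i : CSeries) u * X j)

/-- The substitution family `zᵢ ↦ H`, `z_l ↦ z_l` (`l ≠ i`). -/
local notation3 "covFam[" i ", " j ", " u "]" =>
  (fun l : ℕ => if l = i then covH[i, j, u] else (X l : CSeries))

/-- The substitution family `zᵢ ↦ u(zᵢ)`, `z_l ↦ z_l` (`l ≠ i`). -/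
local notation3 "uFam[" i ", " u "]" =>
  (fun l : ℕ => if l = i then Polynomial.aeval (X i : CSeries) u else (X l : CSeries))

/-! ## Injective polynomial substitutions of `k[z]` -/

section Alg

variable {k : Type} [Field k]

/-- **`zᵢ ↦ zᵢ(1 − z_j) + w z_j` (`z_l ↦ z_l` otherwise) is injective on `k[z]`** for `i ≠ j` and
any `w ∈ k[z]`: modulo `z_j` the substitution is the identity, so a kernel element `p` has
`p|_{z_j=0} = 0`, i.e. `p = z_j p₁` with `p₁` again in the kernel and of smaller total degree.
[folklore] -/
theorem v1_polyMap_injective {i j : ℕ} (hij : i ≠ j) (w : MvPolynomial ℕ k) :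
    Function.Injective (MvPolynomial.bind₁ fun l : ℕ =>
      if l = i then MvPolynomial.X i * (1 - MvPolynomial.X j) + w * MvPolynomial.X j
      else MvPolynomial.X l) := by
  -- adapted from `s8_descent` (SymplecticScissorsTypeAGenerationStubRestrCZero.lean)
  classical
  set g : ℕ → MvPolynomial ℕ k := fun l : ℕ =>
    if l = i then MvPolynomial.X i * (1 - MvPolynomial.X j) + w * MvPolynomial.X j
    else MvPolynomial.X l with hg
  set ev : MvPolynomial ℕ k →+* MvPolynomial ℕ k :=
    MvPolynomial.eval₂Hom MvPolynomial.C (Function.update MvPolynomial.X j 0) with hev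
  have hcomp : ev.comp (MvPolynomial.bind₁ g).toRingHom = ev := by
    refine MvPolynomial.ringHom_ext (fun c => ?_) (fun l => ?_)
    · rw [RingHom.comp_apply, AlgHom.toRingHom_eq_coe, RingHom.coe_coe, MvPolynomial.bind₁_C_right]
    · rw [RingHom.comp_apply, AlgHom.toRingHom_eq_coe, RingHom.coe_coe, MvPolynomial.bind₁_X_right]
      by_cases hl : l = i
      · subst hl
        simp only [hg, if_true]
        rw [map_add, map_mul, map_mul, map_sub, map_one, hev, s8_ev_X_self, s8_ev_X_of_ne k hij]
        ring
      · simp only [hg, if_neg hl]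
  rw [injective_iff_map_eq_zero]
  intro p hp
  by_contra hp0
  have hex : ∃ n, ∃ q : MvPolynomial ℕ k, q ≠ 0 ∧ MvPolynomial.bind₁ g q = 0 ∧ q.totalDegree = n :=
    ⟨_, p, hp0, hp, rfl⟩
  obtain ⟨q, hq0, hq, hdeg⟩ := Nat.find_spec hex
  have hevq : ev q = 0 := by
    rw [← hcomp, RingHom.comp_apply, AlgHom.toRingHom_eq_coe, RingHom.coe_coe, hq, map_zero]
  have hdvd : (MvPolynomial.X j : MvPolynomial ℕ k) ∣ q := by
    have h := s8_X_dvd_sub_ev k j q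
    rwa [← hev, hevq, sub_zero] at h
  obtain ⟨q₁, rfl⟩ := hdvd
  have hq₁0 : q₁ ≠ 0 := by
    rintro rfl
    exact hq0 (mul_zero _)
  have hq₁ : MvPolynomial.bind₁ g q₁ = 0 := by
    rw [map_mul, MvPolynomial.bind₁_X_right] at hq
    simp only [hg, if_neg (Ne.symm hij)] at hq
    exact (mul_eq_zero.mp hq).resolve_left (MvPolynomial.X_ne_zero j)
  have hlt : q₁.totalDegree < (MvPolynomial.X j * q₁).totalDegree := by
    rw [MvPolynomial.totalDegree_mul_of_isDomain (MvPolynomial.X_ne_zero j) hq₁0,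
      MvPolynomial.totalDegree_X]
    omega
  rw [hdeg] at hlt
  exact Nat.find_min hex hlt ⟨q₁, hq₁0, hq₁, rfl⟩

/-- **`zᵢ ↦ u₀(zᵢ)` (`z_l ↦ z_l` otherwise) is injective on `k[z]`** for a non-constant `u₀ ∈ k[t]`
(Mathlib: the family `(f_l(z_l))_l` is algebraically independent for transcendental `f_l ∈ k[t]`).
[folklore] -/
theorem v1_uMap_injective (i : ℕ) {u₀ : Polynomial k} (hu₀ : u₀.natDegree ≠ 0) :
    Function.Injective (MvPolynomial.bind₁ fun l : ℕ =>
      if l = i then Polynomial.aeval (MvPolynomial.X i : MvPolynomial ℕ k) u₀ else MvPolynomial.X l) := by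
  have h := MvPolynomial.algebraicIndependent_polynomial_aeval_X (ι := ℕ) (R := k)
    (fun l => if l = i then u₀ else Polynomial.X) (fun l => by
      split_ifs
      · exact Polynomial.transcendental u₀ hu₀ (mem_nonZeroDivisors_of_ne_zero
          (Polynomial.leadingCoeff_ne_zero.mpr fun h => hu₀ (by rw [h, Polynomial.natDegree_zero])))
      · exact Polynomial.transcendental_X k)
  have hg : (fun l : ℕ => if l = i then Polynomial.aeval (MvPolynomial.X i : MvPolynomial ℕ k) u₀
      else MvPolynomial.X l) =
      fun l => Polynomial.aeval (MvPolynomial.X l : MvPolynomial ℕ k) (if l = i then u₀ else Polynomial.X) := by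
    funext l
    split_ifs with hl
    · rw [hl]
    · rw [Polynomial.aeval_X]
  rw [hg, ← MvPolynomial.aeval_eq_bind₁]
  exact h

variable (σ : k →+* ℂ)

/-- `polyToCSeries σ` maps `u₀(zᵢ) ∈ k[z]` to `u(zᵢ) ∈ ℂ[[z]]`, `u = σ(u₀)`. [folklore] -/
theorem v1_polyToCSeries_aeval (i : ℕ) (u₀ : Polynomial k) :
    polyToCSeries σ (Polynomial.aeval (MvPolynomial.X i : MvPolynomial ℕ k) u₀) =
      Polynomial.aeval (X i : CSeries) (u₀.map σ) := by
  rw [Polynomial.aeval_def, Polynomial.aeval_def, Polynomial.eval₂_map, Polynomial.hom_eval₂,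
    s3_polyToCSeries_X]
  congr 1
  refine RingHom.ext fun c => ?_
  rw [RingHom.comp_apply, RingHom.comp_apply, MvPolynomial.algebraMap_eq, s3_polyToCSeries_C,
    ← MvPowerSeries.c_eq_algebraMap]

/-- **Transport of algebraicity along a substitution.** If `a : ℕ → ℂ[[z]]` is substitutable and is
the image under `polyToCSeries σ` of a family `g : ℕ → k[z]` whose substitution `bind₁ g` is
injective on `k[z]`, then `subst a F` is algebraic over `k(z)` whenever `F` is: the square
`subst a ∘ polyToCSeries σ = polyToCSeries σ ∘ bind₁ g` commutes (check on `C c` and `z_l`), so a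
relation `P(F) = 0` gives `(P^g)(subst a F) = subst a (P(F)) = 0` with `P^g ≠ 0`. [folklore] -/
theorem v1_isAlgebraic_subst {a : ℕ → CSeries} (ha : HasSubst a) (g : ℕ → MvPolynomial ℕ k)
    (hg : ∀ l, polyToCSeries σ (g l) = a l) (hinj : Function.Injective (MvPolynomial.bind₁ g))
    {F : CSeries} (hF : IsAlgebraicOverRatFunc σ F) : IsAlgebraicOverRatFunc σ (subst a F) := by
  -- adapted from `s3_isAlgebraic` (SymplecticScissorsTypeAGenerationStubSubstRoomAux.lean)
  set S : CSeries →ₐ[ℂ] CSeries := substAlgHom ha with hS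
  have hfinj : Function.Injective (MvPolynomial.bind₁ g).toRingHom := hinj
  have hsq : S.toRingHom.comp (polyToCSeries σ) =
      (polyToCSeries σ).comp (MvPolynomial.bind₁ g).toRingHom := by
    refine MvPolynomial.ringHom_ext (fun c => ?_) (fun l => ?_)
    · simp only [RingHom.coe_comp, Function.comp_apply, AlgHom.toRingHom_eq_coe, RingHom.coe_coe,
        s3_polyToCSeries_C, hS, substAlgHom_apply, subst_C, MvPolynomial.bind₁_C_right]
    · simp only [RingHom.coe_comp, Function.comp_apply, AlgHom.toRingHom_eq_coe, RingHom.coe_coe,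
        s3_polyToCSeries_X, hS, substAlgHom_apply, subst_X ha, MvPolynomial.bind₁_X_right, hg]
  obtain ⟨P, hP0, hP⟩ := hF
  refine ⟨P.map (MvPolynomial.bind₁ g).toRingHom, (Polynomial.map_ne_zero_iff hfinj).mpr hP0, ?_⟩
  rw [Polynomial.eval₂_map, ← hsq]
  have hT : subst a F = S.toRingHom F := by
    rw [AlgHom.toRingHom_eq_coe, RingHom.coe_coe, hS, substAlgHom_apply]
  rw [hT, ← Polynomial.hom_eval₂, hP, map_zero]

/-- **`f(H)` is algebraic over `k(z)`** for `f` algebraic over `k(z)`, `H = zᵢ(1 − z_j) + u(zᵢ) z_j`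
with `u = σ(u₀)`, `u₀ ∈ k[t]`, `i ≠ j` (given admissibility of the substitution). [folklore] -/
theorem v1_isAlgebraic_cov {i j : ℕ} (hij : i ≠ j) (u₀ : Polynomial k) {f : CSeries}
    (ha : HasSubst covFam[i, j, u₀.map σ]) (hf : IsAlgebraicOverRatFunc σ f) :
    IsAlgebraicOverRatFunc σ (subst covFam[i, j, u₀.map σ] f) := by
  refine v1_isAlgebraic_subst σ ha (fun l : ℕ =>
      if l = i then MvPolynomial.X i * (1 - MvPolynomial.X j) +
        Polynomial.aeval (MvPolynomial.X i : MvPolynomial ℕ k) u₀ * MvPolynomial.X j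
      else MvPolynomial.X l) (fun l => ?_) (v1_polyMap_injective hij _) hf
  split_ifs with hl
  · rw [map_add, map_mul, map_mul, map_sub, map_one, s3_polyToCSeries_X, s3_polyToCSeries_X,
      v1_polyToCSeries_aeval]
  · rw [s3_polyToCSeries_X]

/-- **`f(u(zᵢ))` is algebraic over `k(z)`** for `f` algebraic over `k(z)` and `u = σ(u₀)` with
`u₀ ∈ k[t]` non-constant (given admissibility of the substitution). [folklore] -/
theorem v1_isAlgebraic_u (i : ℕ) {u₀ : Polynomial k} (hu₀ : u₀.natDegree ≠ 0) {f : CSeries}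
    (ha : HasSubst uFam[i, u₀.map σ]) (hf : IsAlgebraicOverRatFunc σ f) :
    IsAlgebraicOverRatFunc σ (subst uFam[i, u₀.map σ] f) := by
  refine v1_isAlgebraic_subst σ ha (fun l : ℕ =>
      if l = i then Polynomial.aeval (MvPolynomial.X i : MvPolynomial ℕ k) u₀ else MvPolynomial.X l)
    (fun l => ?_) (v1_uMap_injective i hu₀) hf
  split_ifs with hl
  · rw [v1_polyToCSeries_aeval]
  · rw [s3_polyToCSeries_X]

end Alg

/-! ## The degenerate substitution `u = 0`: `f(0) = f|_{zᵢ=0}` -/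

/-- For a one-variable `f` (variable `zᵢ`) and `u = 0`, the substituted series `f(u(zᵢ))` (with
the coefficient formula of V0) is the face `f|_{zᵢ=0}` (the constant `f(0)`). [folklore] -/
theorem v1_subst_zero_eq_restrC {i : ℕ} {f : CSeries} (hfi : ∀ l : ℕ, UsesVar f l → l = i)
    (hcoeff : ∀ a : ℕ →₀ ℕ, MvPowerSeries.coeff a (MvPowerSeries.subst uFam[i, (0 : Polynomial ℂ)] f) =
      ∑ n ∈ Finset.range (degree a + 1),
        MvPowerSeries.coeff (Finsupp.single i n) f *
          MvPowerSeries.coeff a (Polynomial.aeval (X i : CSeries) (0 : Polynomial ℂ) ^ n)) :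
    MvPowerSeries.subst uFam[i, (0 : Polynomial ℂ)] f = restrC i 0 f := by
  classical
  ext a
  rw [hcoeff a, s8_coeff_restrC_zero, Finset.sum_range_succ', Finset.sum_eq_zero fun n _ => ?_]
  · rw [zero_add, pow_zero, single_zero, coeff_zero_eq_constantCoeff_apply, MvPowerSeries.coeff_one]
    by_cases ha : a = 0
    · subst ha
      simp
    · rw [if_neg ha, mul_zero]
      split_ifs with hai
      · -- `a ≠ 0`, `a i = 0`: some `l ≠ i` has `a l ≠ 0`, and `f` does not involve `z_l`
        obtain ⟨l, hl⟩ : ∃ l, a l ≠ 0 := by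
          by_contra h
          push Not at h
          exact ha (Finsupp.ext h)
        by_contra hne
        have hli : l = i := hfi l ⟨a, hl, Ne.symm hne⟩
        rw [hli] at hl
        exact hl hai
      · rfl
  · rw [map_zero, zero_pow (Nat.succ_ne_zero n), map_zero, mul_zero]

/-! ## Registered form -/

/-- **V1 — MEMBERSHIP of the substituted series**, GIVEN V0: for `u ∈ ℚ̄[t]` (`u(0) = 0`) and
`f ∈ 𝒪_{ℚ-alg}(𝔻̄^∞)` one-variable with room, `f(H)` and `f(u(zᵢ))` lie in `𝒪_{ℚ-alg}(𝔻̄^∞)`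
(variables and polyradius from V0; algebraic over `ℚ̄(z)` by substituting into an equation of `f` —
the substitution `zᵢ ↦ H`, `z_j ↦ z_j` is injective on `ℚ̄[z]` since `H ≡ zᵢ (mod z_j)`, and
`zᵢ ↦ u(zᵢ)` is injective for non-constant `u` —, hence over `ℚ(z)` by
`Oan_algebraicClosure_eq_Oan_rat`; for `u = 0`, `f(u(zᵢ)) = f|_{zᵢ=0}`). [folklore] -/
theorem stub_covSubstMemOan_of :
    (∀ (i j : ℕ), i ≠ j → ∀ (u : Polynomial ℂ), u.eval 0 = 0 →
      ∀ (f : CSeries), (∀ l : ℕ, UsesVar f l → l = i) →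
      ∀ (r : ℝ), 2 + (∑ n ∈ u.support, ‖u.coeff n‖) < r →
        Summable (fun a : ℕ →₀ ℕ => ‖MvPowerSeries.coeff a f‖ * r ^ degree a) →
        MvPowerSeries.HasSubst covFam[i, j, u] ∧ MvPowerSeries.HasSubst uFam[i, u] ∧
        (∀ l : ℕ, UsesVar (MvPowerSeries.subst covFam[i, j, u] f) l → l = i ∨ l = j) ∧
        (∀ l : ℕ, UsesVar (MvPowerSeries.subst uFam[i, u] f) l → l = i) ∧
        (∀ a : ℕ →₀ ℕ, MvPowerSeries.coeff a (MvPowerSeries.subst covFam[i, j, u] f) =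
          ∑ n ∈ Finset.range (degree a + 1),
            MvPowerSeries.coeff (Finsupp.single i n) f * MvPowerSeries.coeff a (covH[i, j, u] ^ n)) ∧
        (∀ a : ℕ →₀ ℕ, MvPowerSeries.coeff a (MvPowerSeries.subst uFam[i, u] f) =
          ∑ n ∈ Finset.range (degree a + 1),
            MvPowerSeries.coeff (Finsupp.single i n) f *
              MvPowerSeries.coeff a (Polynomial.aeval (X i : CSeries) u ^ n)) ∧
        (∃ ρ : ℝ, 1 < ρ ∧ ∃ q : ℝ, q < r ∧
          (∃ Q : ℝ, Q ≤ q ∧ HasSum (fun a : ℕ →₀ ℕ =>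
            ‖MvPowerSeries.coeff a (covH[i, j, u])‖ * a.prod fun _ n => ρ ^ n) Q) ∧
          (Summable fun a : ℕ →₀ ℕ =>
            ‖MvPowerSeries.coeff a (MvPowerSeries.subst covFam[i, j, u] f)‖ * a.prod fun _ n => ρ ^ n) ∧
          (Summable fun a : ℕ →₀ ℕ =>
            ‖MvPowerSeries.coeff a (MvPowerSeries.subst uFam[i, u] f)‖ * a.prod fun _ n => ρ ^ n) ∧
          (∀ ε : ℝ, 0 < ε → ∃ N : ℕ, ∀ N' : ℕ, N ≤ N' → ∃ E : ℝ, E < ε ∧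
            HasSum (fun a : ℕ →₀ ℕ => ‖MvPowerSeries.coeff a
              (MvPowerSeries.subst covFam[i, j, u] f -
                ∑ n ∈ Finset.range N', MvPowerSeries.coeff (Finsupp.single i n) f • covH[i, j, u] ^ n)‖ *
              a.prod fun _ n => ρ ^ n) E))) →
    ∀ (i j : ℕ), i ≠ j → ∀ (u : Polynomial ℂ), (∀ n, IsAlgebraic ℚ (u.coeff n)) → u.eval 0 = 0 →
      ∀ (f : CSeries), f ∈ Oan (algebraMap ℚ ℂ) → (∀ l : ℕ, UsesVar f l → l = i) →
      ∀ (r : ℝ), 2 + (∑ n ∈ u.support, ‖u.coeff n‖) < r →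
        Summable (fun a : ℕ →₀ ℕ => ‖MvPowerSeries.coeff a f‖ * r ^ degree a) →
        MvPowerSeries.subst covFam[i, j, u] f ∈ Oan (algebraMap ℚ ℂ) ∧
        MvPowerSeries.subst uFam[i, u] f ∈ Oan (algebraMap ℚ ℂ) := by
  intro hV0 i j hij u hualg hu0 f hfOan hfi r hr hsum
  obtain ⟨hHS1, hHS2, hU1, hU2, -, hC2, ρ, hρ, -, -, -, hS1, hS2, -⟩ :=
    hV0 i j hij u hu0 f hfi r hr hsum
  -- finitely many variables and polyradius, read off V0
  have hdep1 : DependsOnlyOnLT (MvPowerSeries.subst covFam[i, j, u] f) (max i j + 1) :=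
    s6_dependsOnlyOnLT_of_usesVar fun l hl => by
      rcases hU1 l hl with rfl | rfl <;> omega
  have hdep2 : DependsOnlyOnLT (MvPowerSeries.subst uFam[i, u] f) (i + 1) :=
    s6_dependsOnlyOnLT_of_usesVar fun l hl => by
      rw [hU2 l hl]
      exact Nat.lt_succ_self i
  have hrad1 : HasPolyradiusGtOne (MvPowerSeries.subst covFam[i, j, u] f) :=
    ⟨ρ, hρ, by simpa only [s4_prod_const_pow] using hS1⟩
  have hrad2 : HasPolyradiusGtOne (MvPowerSeries.subst uFam[i, u] f) :=
    ⟨ρ, hρ, by simpa only [s4_prod_const_pow] using hS2⟩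
  -- the degenerate case `u = 0`
  by_cases hu : u = 0
  · subst hu
    have h2 : MvPowerSeries.subst uFam[i, (0 : Polynomial ℂ)] f ∈ Oan (algebraMap ℚ ℂ) := by
      rw [v1_subst_zero_eq_restrC hfi hC2]
      exact (stub_restrCZeroMemOan ℚ (algebraMap ℚ ℂ) f hfOan i).1
    refine ⟨?_, h2⟩
    obtain ⟨u₀, hu₀⟩ := pb_lift (0 : Polynomial ℂ) hualg
    rw [← Oan_algebraicClosure_eq_Oan_rat]
    have hfK : f ∈ Oan (algebraMap (algebraicClosure ℚ ℂ) ℂ) := Oan_rat_subset _ hfOan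
    rw [← hu₀] at hHS1 ⊢
    exact ⟨⟨_, by rw [hu₀]; exact hdep1⟩, by rw [hu₀]; exact hrad1,
      v1_isAlgebraic_cov _ hij u₀ hHS1 hfK.2.2⟩
  -- `u ≠ 0`: lift `u` to `ℚ̄[t]` and work over `ℚ̄`
  obtain ⟨u₀, rfl⟩ := pb_lift u hualg
  have hfK : f ∈ Oan (algebraMap (algebraicClosure ℚ ℂ) ℂ) := Oan_rat_subset _ hfOan
  have hdeg : u₀.natDegree ≠ 0 := by
    intro h0
    apply hu
    have hc : u₀.coeff 0 = 0 := by
      apply (algebraMap (algebraicClosure ℚ ℂ) ℂ).injective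
      rw [map_zero, ← Polynomial.coeff_map, Polynomial.coeff_zero_eq_eval_zero, hu0]
    rw [Polynomial.eq_C_of_natDegree_eq_zero h0, hc, map_zero, Polynomial.map_zero]
  rw [← Oan_algebraicClosure_eq_Oan_rat]
  exact ⟨⟨⟨_, hdep1⟩, hrad1, v1_isAlgebraic_cov _ hij u₀ hHS1 hfK.2.2⟩,
    ⟨⟨_, hdep2⟩, hrad2, v1_isAlgebraic_u _ i hdeg hHS2 hfK.2.2⟩⟩

end Summit.KontsevichZagierPeriods.KontsevichZagierPeriods.TypeAGenerationLine
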